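import Literature.NumberTheory.EllipticCurves.MatsunoTwistedCurves
import Mathlib.NumberTheory.RamificationInertia.Galois
import Mathlib.NumberTheory.NumberField.Ideal.Basic
import Mathlib.FieldTheory.Minpoly.IsIntegrallyClosed
import Mathlib.Algebra.QuadraticDiscriminant
import Mathlib.RingTheory.DedekindDomain.Ideal.Lemmas
import Mathlib.NumberTheory.LSeries.PrimesInAP
import Mathlib.Data.Nat.Squarefree
import Mathlib.Data.Nat.Factorization.Basic
import Mathlib.Data.Nat.ChineseRemainder
import Mathlib.FieldTheory.Finite.Basic
import HarnessLib

/-!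
# Matsuno 2009, §6: the primes `ℓ_i, m_j` exist for every quadratic field (discharge)

`Proofs` companion of `Literature/NumberTheory/EllipticCurves/MatsunoTwistedCurves.lean`, which
vendors — as the named fact `Literature.NumberTheory.EllipticCurves.Matsuno2009_sec6_exists_primes`
— the existence of the primes of K. Matsuno, *Elliptic curves with large Tate–Shafarevich groups
over a number field*, Math. Res. Lett. 16 (2009), §6 (p. 459: "take distinct odd primes
`ℓ₁, ⋯, ℓ_k, m₁, ⋯, m_k` satisfying the conditions (A1), (A3) and (A4) … We can indeed take such
primes by the Chebotarev density theorem"), in the corrected form recorded there: for a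
quadratic field `K` and every `k`, injective families of primes `ℓ_i ≡ 1 (mod 4)` (A1) and odd
`m_j` with `m_j 𝓞_K` prime ((A3) for the `m_j`) and `(m_j/ℓ_i) = (-1)^{δ_ij}` (A4). This file
PROVES it (`Matsuno2009_sec6_exists_primes_holds`) from Mathlib — Dirichlet's theorem on primes
in arithmetic progressions (`Nat.forall_exists_prime_gt_and_modEq`), the Chinese remainder
theorem, quadratic reciprocity for the Jacobi symbol, and the fundamental identity
`g · e · f = [K : ℚ]` for Galois extensions — replacing the instance of the Chebotarev density
theorem quoted in print by the classical argument for quadratic fields: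

* `QuadraticFieldAux.exists_natDegree_minpoly_eq_two`: a quadratic field contains an algebraic
  integer `x` of degree `2` (else `𝓞_K = ℤ` would have rank `1`, `RingOfIntegers.rank`); write
  `X² + bX + c` for its minimal polynomial and `D = b² - 4c`;
* `QuadraticFieldAux.not_isSquare_disc`: `D` is not a square in `ℤ` (else `X² + bX + c` has
  the rational root `(-b + √D)/2`, contradicting irreducibility over `ℚ`);
* `QuadraticFieldAux.isPrime_span_of_not_isSquare`: **an odd prime `q` with `(D/q) = -1`
  remains prime in `K`**: a prime `𝔮 ∣ q` of residue degree `1` would give a ring homomorphism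
  `𝓞_K → 𝔽_q`, mapping `x` to a root of `X² + bX + c`, so `D = (2x + b)²` would be a square
  mod `q`; hence `f(𝔮/q) ≠ 1`, and `g e f = 2` (Mathlib's
  `Ideal.ncard_primesOver_mul_ramificationIdxIn_mul_inertiaDegIn`) forces `f = 2`, `g = e = 1`,
  so `q 𝓞_K = 𝔮` by unique factorisation of ideals;
* `QuadraticFieldAux.exists_prime_jacobiSym_eq_neg_one`: **a non-square `D` is a non-residue
  modulo some odd prime `c > |D|`**, by the classical case analysis `|D| = 2^w b² a` (`a` odd
  square-free): if `a ≠ 1`, reciprocity reduces `J(D|c)` for `c ≡ 1 (mod 8(a/p))`,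
  `c ≡ g (mod p)` (`p ∣ a` prime, `g` a non-residue) to `J(g|p) = -1`; if `a = 1`, use
  `χ₈(c) = -1` for `c ≡ 5 (mod 8)` (odd `w`) or `χ₄(c) = -1` for `c ≡ 3 (mod 4)` (`D < 0`);
  the prime `c` in the required class is supplied by Dirichlet's theorem;
* `QuadraticFieldAux.exists_prime_gt_modEq_family`: primes in simultaneously prescribed classes
  modulo pairwise coprime moduli (CRT + Dirichlet);
* assembly (`Matsuno2009_sec6_exists_primes_holds`): the `ℓ_i` are distinct primes
  `≡ 1 (mod 4)` larger than `4|D|` (Dirichlet); each `m_j` is a prime `≡ c (mod 4|D|)` — so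
  `J(D|m_j) = J(D|c) = -1` (`jacobiSym.mod_right`) and `m_j` remains prime in `K` — with
  `m_j ≡ g_i` or `1 (mod ℓ_i)` according as `i = j` or not, giving (A4)
  `(m_j/ℓ_i) = (-1)^{δ_ij}`; distinctness of the `m_j` follows from the sign pattern, and
  `ℓ_i ≠ m_j` from `m_j > ℓ_i`. (Compare `KramerParams.nonempty` in `KramerCurves.lean`, which
  does the (A1)+(A4) half for Kramer's family; the new ingredient here is the inertness of the
  `m_j`.)

## References

* K. Matsuno, Math. Res. Lett. 16 (2009), no. 3, 449–461, §5 (A1)–(A4) (p. 456) and §6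
  (p. 459). [Matsuno2009]
* K. Ireland, M. Rosen, *A Classical Introduction to Modern Number Theory*, 2nd ed., Thm. 5.2.3
  (a non-square is a non-residue modulo infinitely many primes) and §13.1 (splitting of primes in
  quadratic fields) — the classical arguments formalised here (folklore).
-/

noncomputable section

open scoped Classical NumberField

open Polynomial NumberField Ideal UniqueFactorizationMonoid

namespace Literature.NumberTheory.EllipticCurves

namespace QuadraticFieldAux

variable {K : Type*} [Field K] [NumberField K]



/-- A monic polynomial of degree `2` is `X² + bX + c` with `b, c` its coefficients. [folklore] -/
theorem eq_X_sq_add_of_monic_of_natDegree_eq_two {R : Type*} [CommRing R] {p : R[X]}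
    (hp : p.Monic) (hdeg : p.natDegree = 2) :
    p = X ^ 2 + C (p.coeff 1) * X + C (p.coeff 0) := by
  have h := hp.as_sum
  rw [hdeg, Finset.sum_range_succ, Finset.sum_range_succ, Finset.sum_range_zero] at h
  rw [h]
  simp only [pow_zero, mul_one, pow_one, zero_add, coeff_add, coeff_X_pow, coeff_C_mul,
    coeff_X, coeff_C]
  norm_num
  ring

/-- **A quadratic field contains an algebraic integer of degree `2`**: if every element of
`𝓞 K` had a minimal polynomial of degree `1` over `ℤ`, then `𝓞 K = ℤ` would have rank `1`,
not `[K : ℚ] = 2` (`RingOfIntegers.rank`). [folklore] -/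
theorem exists_natDegree_minpoly_eq_two (hK : Module.finrank ℚ K = 2) :
    ∃ x : 𝓞 K, (minpoly ℤ x).natDegree = 2 := by
  by_contra h
  push Not at h
  have hall : ∀ x : 𝓞 K, x ∈ (algebraMap ℤ (𝓞 K)).range := by
    intro x
    by_contra hx
    have hint : IsIntegral ℤ x := IsIntegralClosure.isIntegral ℤ K x
    have h2 := (minpoly.two_le_natDegree_iff hint).mpr hx
    -- `deg_ℤ = deg_ℚ ≤ [K : ℚ] = 2`
    have hle : (minpoly ℤ x).natDegree ≤ 2 := by
      have hintK : IsIntegral ℤ (x : K) := x.isIntegral_coe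
      have heq : minpoly ℚ (x : K) = (minpoly ℤ x).map (algebraMap ℤ ℚ) := by
        rw [← minpoly.algebraMap_eq (IsFractionRing.injective (𝓞 K) K) x]
        exact minpoly.isIntegrallyClosed_eq_field_fractions' ℚ hintK
      have h1 : (minpoly ℚ (x : K)).natDegree = (minpoly ℤ x).natDegree := by
        rw [heq, natDegree_map_eq_of_injective (algebraMap ℤ ℚ).injective_int]
      rw [← h1, ← hK]
      exact minpoly.natDegree_le (x : K)
    exact h x (le_antisymm hle h2)
  have hsurj : Function.Surjective (Algebra.linearMap ℤ (𝓞 K)) := fun x => hall x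
  have hle := LinearMap.finrank_range_le (Algebra.linearMap ℤ (𝓞 K))
  rw [LinearMap.range_eq_top.mpr hsurj, finrank_top, RingOfIntegers.rank, hK,
    Module.finrank_self] at hle
  omega

omit [NumberField K] in
/-- For an algebraic integer `x` of degree `2` with minimal polynomial `X² + bX + c` and a
ring homomorphism `φ : 𝓞 K → R`, `φ(x)² + b φ(x) + c = 0`. [folklore] -/
theorem quadratic_apply_eq_zero {x : 𝓞 K} (hdeg : (minpoly ℤ x).natDegree = 2) {R : Type*}
    [CommRing R] (φ : 𝓞 K →+* R) :
    1 * (φ x * φ x) + ((minpoly ℤ x).coeff 1 : R) * φ x + ((minpoly ℤ x).coeff 0 : R) = 0 := by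
  have h0 : aeval x (minpoly ℤ x) = 0 := minpoly.aeval ℤ x
  have h1 : aeval (φ.toIntAlgHom x) (minpoly ℤ x) = 0 := by
    rw [aeval_algHom_apply, h0, map_zero]
  rw [eq_X_sq_add_of_monic_of_natDegree_eq_two (minpoly.monic (IsIntegralClosure.isIntegral ℤ K x))
    hdeg] at h1
  simp only [map_add, map_mul, aeval_X_pow, aeval_C, aeval_X] at h1
  simp only [algebraMap_int_eq, eq_intCast, RingHom.toIntAlgHom_apply] at h1
  -- `h1 : φ x ^ 2 + b * φ x + c = 0`
  linear_combination h1

/-- **The discriminant of a degree-`2` algebraic integer is not a square in `ℤ`**: otherwise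
`X² + bX + c` would have the rational root `(-b + r)/2`, contradicting the irreducibility of
the minimal polynomial over `ℚ`. [folklore] -/
theorem not_isSquare_disc {x : 𝓞 K} (hdeg : (minpoly ℤ x).natDegree = 2) :
    ¬ IsSquare (discrim (1 : ℤ) ((minpoly ℤ x).coeff 1) ((minpoly ℤ x).coeff 0)) := by
  rintro ⟨r, hr⟩
  have hint : IsIntegral ℤ x := IsIntegralClosure.isIntegral ℤ K x
  have hintK : IsIntegral ℤ (x : K) := x.isIntegral_coe
  have heq : minpoly ℚ (x : K) = (minpoly ℤ x).map (algebraMap ℤ ℚ) := by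
    rw [← minpoly.algebraMap_eq (IsFractionRing.injective (𝓞 K) K) x]
    exact minpoly.isIntegrallyClosed_eq_field_fractions' ℚ hintK
  have hirr : Irreducible (minpoly ℚ (x : K)) := minpoly.irreducible hintK.tower_top
  have hQ := eq_X_sq_add_of_monic_of_natDegree_eq_two (minpoly.monic hint) hdeg
  have hD := hr
  set b : ℤ := (minpoly ℤ x).coeff 1 with hb
  set c : ℤ := (minpoly ℤ x).coeff 0 with hc
  rw [discrim] at hD
  have hD' : (b : ℚ) ^ 2 - 4 * 1 * c = r * r := by exact_mod_cast hD
  -- the rational root `(-b + r) / 2`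
  have hroot : (minpoly ℚ (x : K)).IsRoot ((-(b : ℚ) + r) / 2) := by
    rw [heq, hQ]
    simp only [Polynomial.map_add, Polynomial.map_mul, Polynomial.map_pow, map_X,
      Polynomial.map_C, IsRoot.def, eval_add, eval_pow, eval_X, eval_mul, eval_C]
    simp only [algebraMap_int_eq, eq_intCast]
    linear_combination (-1 / 4 : ℚ) * hD'
  have h1 := degree_eq_one_of_irreducible_of_root hirr hroot
  have h2 : (minpoly ℚ (x : K)).natDegree = 2 := by
    rw [heq, natDegree_map_eq_of_injective (algebraMap ℤ ℚ).injective_int, hdeg]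
  rw [degree_eq_natDegree hirr.ne_zero, h2] at h1
  exact absurd h1 (by decide)

omit [NumberField K] in
/-- **No ring homomorphism `𝓞 K → 𝔽_q` when the discriminant is a non-residue**: the image of
a degree-`2` integer `x` would be a root of `X² + bX + c` in `𝔽_q`, making
`b² - 4c = (2y + b)²` a square. [folklore] -/
theorem isSquare_disc_of_ringHom {x : 𝓞 K} (hdeg : (minpoly ℤ x).natDegree = 2) {q : ℕ}
    (φ : 𝓞 K →+* ZMod q) : IsSquare ((discrim (1 : ℤ) ((minpoly ℤ x).coeff 1) ((minpoly ℤ x).coeff 0) : ℤ) : ZMod q) := by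
  have h := discrim_eq_sq_of_quadratic_eq_zero (quadratic_apply_eq_zero hdeg φ)
  refine ⟨2 * 1 * φ x + ((minpoly ℤ x).coeff 1 : ZMod q), ?_⟩
  rw [← sq, ← h, discrim, discrim]
  push_cast
  ring

/-- The prime ideal of `ℤ` at a rational prime is maximal. [folklore] -/
theorem isMaximal_span_int {q : ℕ} (hq : q.Prime) : (span {(q : ℤ)}).IsMaximal :=
  ((span_singleton_prime (by exact_mod_cast hq.ne_zero)).mpr
    (Nat.prime_iff_prime_int.mp hq)).isMaximal (by simpa using (Nat.prime_iff_prime_int.mp hq).ne_zero)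

/-- **Inertia degree `≠ 1` at a non-residue prime**: if `q` is a prime with `b² - 4c` a
non-residue mod `q`, every prime `𝔮` of `𝓞 K` above `q` has `f(𝔮/q) ≠ 1` — otherwise
`𝓞 K/𝔮 ≅ 𝔽_q` would be a ring homomorphism `𝓞 K → 𝔽_q`. [folklore] -/
theorem inertiaDeg_ne_one {x : 𝓞 K} (hdeg : (minpoly ℤ x).natDegree = 2) {q : ℕ}
    (hq : q.Prime) (hD : ¬ IsSquare ((discrim (1 : ℤ) ((minpoly ℤ x).coeff 1) ((minpoly ℤ x).coeff 0) : ℤ) : ZMod q))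
    (Q : (span {(q : ℤ)}).primesOver (𝓞 K)) : Q.1.inertiaDeg ℤ ≠ 1 := by
  intro h1
  haveI := isMaximal_span_int hq
  haveI : Q.1.IsMaximal := Ideal.IsPrime.isMaximal inferInstance
    (Ideal.ne_bot_of_liesOver_of_ne_bot (p := span {(q : ℤ)})
      (by simpa using (Nat.prime_iff_prime_int.mp hq).ne_zero) Q.1)
  have hcard : absNorm Q.1 = q := by
    rw [Ideal.absNorm_eq_pow_inertiaDeg' Q.1 hq, Ideal.inertiaDeg'_eq_inertiaDeg (span {(q : ℤ)}) Q.1,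
      h1, pow_one]
  rw [Ideal.absNorm_apply, Submodule.cardQuot_apply] at hcard
  haveI : Finite (𝓞 K ⧸ Q.1) := Nat.finite_of_card_ne_zero (by rw [hcard]; exact hq.ne_zero)
  letI : Fintype (𝓞 K ⧸ Q.1) := Fintype.ofFinite _
  have hcard' : Fintype.card (𝓞 K ⧸ Q.1) = q := by rw [Fintype.card_eq_nat_card, hcard]
  let e : ZMod q ≃+* 𝓞 K ⧸ Q.1 := ZMod.ringEquivOfPrime (𝓞 K ⧸ Q.1) hq hcard'
  exact hD (isSquare_disc_of_ringHom hdeg ((e.symm : 𝓞 K ⧸ Q.1 →+* ZMod q).comp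
    (Ideal.Quotient.mk Q.1)))

/-- **A non-residue prime is inert in a quadratic field** (Galois over `ℚ`): with `q` a prime
and `b² - 4c` a non-residue mod `q`, `q` has inertia degree `2` in `K/ℚ`, a unique prime
above it, and ramification index `1` (`g e f = 2`, `f ≠ 1`). [folklore] -/
theorem inertiaDegIn_eq_two [IsGalois ℚ K] (hK : Module.finrank ℚ K = 2) {x : 𝓞 K}
    (hdeg : (minpoly ℤ x).natDegree = 2) {q : ℕ} (hq : q.Prime)
    (hD : ¬ IsSquare ((discrim (1 : ℤ) ((minpoly ℤ x).coeff 1) ((minpoly ℤ x).coeff 0) : ℤ) : ZMod q)) :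
    (span {(q : ℤ)}).inertiaDegIn (𝓞 K) = 2 ∧ (span {(q : ℤ)}).ramificationIdxIn (𝓞 K) = 1 ∧
      ((span {(q : ℤ)}).primesOver (𝓞 K)).ncard = 1 := by
  haveI := isMaximal_span_int hq
  obtain ⟨Q⟩ := (inferInstance : Nonempty ((span {(q : ℤ)}).primesOver (𝓞 K)))
  have hf := inertiaDeg_ne_one hdeg hq hD Q
  have hprod := ncard_primesOver_mul_ramificationIdxIn_mul_inertiaDegIn (span {(q : ℤ)}) (𝓞 K)
    (K ≃ₐ[ℚ] K)
  rw [IsGalois.card_aut_eq_finrank, hK] at hprod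
  rw [inertiaDegIn_eq_inertiaDeg (span {(q : ℤ)}) Q.1 (K ≃ₐ[ℚ] K)] at hprod ⊢
  have hf0 : Q.1.inertiaDeg ℤ ≠ 0 := by
    intro h0; rw [h0] at hprod; simp at hprod
  have he0 : (span {(q : ℤ)}).ramificationIdxIn (𝓞 K) ≠ 0 := by
    intro h0; rw [h0] at hprod; simp at hprod
  have hg0 : ((span {(q : ℤ)}).primesOver (𝓞 K)).ncard ≠ 0 := by
    intro h0; rw [h0] at hprod; simp at hprod
  -- from `g * (e * f) = 2`, `f ∉ {0, 1}`: `f = 2`, `e = g = 1`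
  have hf2 : 2 ≤ Q.1.inertiaDeg ℤ := by omega
  have key : ((span {(q : ℤ)}).primesOver (𝓞 K)).ncard *
      (span {(q : ℤ)}).ramificationIdxIn (𝓞 K) = 1 := by
    nlinarith [Nat.one_le_iff_ne_zero.mpr (mul_ne_zero hg0 he0)]
  refine ⟨by nlinarith, Nat.eq_one_of_mul_eq_one_left key, Nat.eq_one_of_mul_eq_one_right key⟩

omit [NumberField K] in
/-- A prime ideal of `𝓞 K` containing the rational prime `q` lies over `q ℤ`. [folklore] -/
theorem liesOver_span_of_mem {q : ℕ} (hq : q.Prime) {P : Ideal (𝓞 K)} (hP : P.IsPrime)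
    (hmem : (q : 𝓞 K) ∈ P) : P.LiesOver (span {(q : ℤ)}) := by
  haveI := isMaximal_span_int hq
  refine ⟨((isMaximal_span_int hq).eq_of_le (Ideal.comap_ne_top _ hP.ne_top) ?_)⟩
  rw [Ideal.span_singleton_le_iff_mem, Ideal.mem_comap, map_natCast]
  exact hmem

/-- **An inert prime generates a prime ideal**: if the rational prime `q` has a unique prime
`𝔮` of `𝓞 K` above it (`K/ℚ` Galois) with ramification index `1`, then `q 𝓞_K = 𝔮`; in
particular `q 𝓞_K` is a prime ideal ("`q` remains prime in `K`"). Proof: every prime factor of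
`q 𝓞_K` lies over `q`, hence equals `𝔮`, and its multiplicity is `e(𝔮/q) = 1`. [folklore] -/
theorem isPrime_span_of_ncard_eq_one [IsGalois ℚ K] {q : ℕ} (hq : q.Prime)
    (he : (span {(q : ℤ)}).ramificationIdxIn (𝓞 K) = 1)
    (hg : ((span {(q : ℤ)}).primesOver (𝓞 K)).ncard = 1) :
    (span ({(q : 𝓞 K)} : Set (𝓞 K))).IsPrime := by
  haveI := isMaximal_span_int hq
  set I : Ideal (𝓞 K) := span ({(q : 𝓞 K)} : Set (𝓞 K)) with hIdef
  have hI : (span {(q : ℤ)}).map (algebraMap ℤ (𝓞 K)) = I := by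
    rw [Ideal.map_span, Set.image_singleton, map_natCast]
  have hI0 : I ≠ ⊥ := by
    rw [hIdef, Ne, Ideal.span_singleton_eq_bot]
    exact_mod_cast hq.ne_zero
  have hI0' : (span {(q : ℤ)}).map (algebraMap ℤ (𝓞 K)) ≠ ⊥ := hI ▸ hI0
  -- the unique prime over `q`
  obtain ⟨Q⟩ := (inferInstance : Nonempty ((span {(q : ℤ)}).primesOver (𝓞 K)))
  obtain ⟨Q₀, hQ₀⟩ := Set.ncard_eq_one.mp hg
  have huniq : ∀ P : Ideal (𝓞 K), P.IsPrime → I ≤ P → P = Q.1 := by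
    intro P hP hle
    have hPl : P.LiesOver (span {(q : ℤ)}) :=
      liesOver_span_of_mem hq hP (hle (Ideal.subset_span (Set.mem_singleton _)))
    have h1 : P ∈ (span {(q : ℤ)}).primesOver (𝓞 K) := ⟨hP, hPl⟩
    have h2 : (Q : Ideal (𝓞 K)) ∈ (span {(q : ℤ)}).primesOver (𝓞 K) := Q.2
    have h1' : P = Q₀ := by rw [hQ₀] at h1; exact h1
    have h2' : (Q : Ideal (𝓞 K)) = Q₀ := by
      have h3 : (Q : Ideal (𝓞 K)) ∈ ({Q₀} : Set (Ideal (𝓞 K))) := hQ₀ ▸ h2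
      exact h3
    rw [h1', h2']
  -- every prime factor of `I` is `Q`
  have hfac : ∀ P ∈ normalizedFactors I, P = Q.1 := fun P hP =>
    huniq P (Ideal.isPrime_of_prime (prime_of_normalized_factor P hP))
      (Ideal.le_of_dvd (dvd_of_mem_normalizedFactors hP))
  have hrep : normalizedFactors I = Multiset.replicate (Multiset.card (normalizedFactors I)) Q.1 :=
    Multiset.eq_replicate_card.mpr hfac
  -- and its multiplicity is `e = 1`
  have hcount : (normalizedFactors I).count Q.1 = 1 := by
    rw [← hI, ← Ideal.IsDedekindDomain.ramificationIdx_eq_normalizedFactors_count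
      (span {(q : ℤ)}) Q.1 hI0', ← Ideal.ramificationIdxIn_eq_ramificationIdx (span {(q : ℤ)})
      Q.1 (K ≃ₐ[ℚ] K), he]
  have hcard : Multiset.card (normalizedFactors I) = 1 := by
    rw [hrep, Multiset.count_replicate_self] at hcount
    exact hcount
  have hIQ : I = Q.1 := by
    rw [← Ideal.prod_normalizedFactors_eq_self hI0, hrep, hcard]
    simp
  rw [hIQ]
  exact Q.2.1

/-- **A non-residue prime remains prime in a quadratic field**: for `K/ℚ` Galois of degree
`2`, a degree-`2` integer `x ∈ 𝓞 K` with minimal polynomial `X² + bX + c`, and a prime `q` modulo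
which `b² - 4c` is not a square, the ideal `q 𝓞_K` is prime. [folklore] -/
theorem isPrime_span_of_not_isSquare [IsGalois ℚ K] (hK : Module.finrank ℚ K = 2) {x : 𝓞 K}
    (hdeg : (minpoly ℤ x).natDegree = 2) {q : ℕ} (hq : q.Prime)
    (hD : ¬ IsSquare ((discrim (1 : ℤ) ((minpoly ℤ x).coeff 1) ((minpoly ℤ x).coeff 0) : ℤ) : ZMod q)) :
    (span ({(q : 𝓞 K)} : Set (𝓞 K))).IsPrime := by
  obtain ⟨-, he, hg⟩ := inertiaDegIn_eq_two hK hdeg hq hD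
  exact isPrime_span_of_ncard_eq_one hq he hg



/-- `J(b² | c) = 1` for a prime `c` not dividing `b`. [folklore] -/
theorem jacobiSym_sq_eq_one {b c : ℕ} (hc : c.Prime) (hbc : ¬ c ∣ b) :
    jacobiSym ((b : ℤ) ^ 2) c = 1 := by
  apply jacobiSym.sq_one'
  rw [Int.gcd_natCast_natCast]
  exact (Nat.Coprime.symm ((Nat.Prime.coprime_iff_not_dvd hc).mpr hbc))

/-- `χ₈ c = 1` and `χ₄ c = 1` for `c ≡ 1 (mod 8)`. [folklore] -/
theorem χ₈_χ₄_of_mod_eight_eq_one {c : ℕ} (hc : c % 8 = 1) : ZMod.χ₈ c = 1 ∧ ZMod.χ₄ c = 1 := by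
  refine ⟨?_, ZMod.χ₄_nat_one_mod_four (by omega)⟩
  rw [ZMod.χ₈_nat_eq_if_mod_eight]
  have h2 : c % 2 ≠ 0 := by omega
  simp [h2, hc]

/-- `χ₈ c = -1` and `χ₄ c = 1` for `c ≡ 5 (mod 8)`. [folklore] -/
theorem χ₈_χ₄_of_mod_eight_eq_five {c : ℕ} (hc : c % 8 = 5) :
    ZMod.χ₈ c = -1 ∧ ZMod.χ₄ c = 1 := by
  refine ⟨?_, ZMod.χ₄_nat_one_mod_four (by omega)⟩
  rw [ZMod.χ₈_nat_eq_if_mod_eight]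
  have h2 : c % 2 ≠ 0 := by omega
  have h1 : ¬ (c % 8 = 1 ∨ c % 8 = 7) := by omega
  simp [h2, h1]

/-- `J(±1 | c) = 1` for `c ≡ 1 (mod 4)`. [folklore] -/
theorem jacobiSym_sign_eq_one {D : ℤ} (hD : D ≠ 0) {c : ℕ} (hc : c % 4 = 1) :
    jacobiSym D.sign c = 1 := by
  rcases lt_or_gt_of_ne hD with h | h
  · rw [Int.sign_eq_neg_one_of_neg h, jacobiSym.at_neg_one (Nat.odd_iff.mpr (by omega)),
      ZMod.χ₄_nat_one_mod_four hc]
  · rw [Int.sign_eq_one_of_pos h, jacobiSym.one_left]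

/-- **A non-square integer is a non-residue modulo a suitable prime**: for `D ≠ 0` not a
square in `ℤ` there is an odd prime `c > |D|` (in particular `c ∤ 2D`) with Jacobi symbol
`J(D | c) = -1`. Proof: write `|D| = 2^w b² a` with `a` odd square-free. If `a ≠ 1`, pick an
odd prime `p ∣ a`, a non-residue `g mod p`, and (Dirichlet) a prime `c ≡ 1 (mod 8(a/p))`,
`c ≡ g (mod p)`; then `J(D|c) = J(a|c) = J(c|a) = J(g|p) J(1|a/p) = -1` by reciprocity. If
`a = 1`, then `D = ±2^w b²` with `w` odd or the sign negative: take `c ≡ 5 (mod 8)`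
(`χ₈(c) = -1`), resp. `c ≡ 3 (mod 4)` (`χ₄(c) = -1`). [folklore] -/
theorem exists_prime_jacobiSym_eq_neg_one {D : ℤ} (hD0 : D ≠ 0) (hD : ¬ IsSquare D) :
    ∃ c : ℕ, c.Prime ∧ Odd c ∧ D.natAbs < c ∧ jacobiSym D c = -1 := by
  set n : ℕ := D.natAbs with hn
  have hn0 : n ≠ 0 := Int.natAbs_ne_zero.mpr hD0
  obtain ⟨w, n₁, hn₁, hnw⟩ := Nat.exists_eq_two_pow_mul_odd hn0
  obtain ⟨a, b, hba, ha⟩ := Nat.sq_mul_squarefree n₁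
  have hn₁0 : n₁ ≠ 0 := fun h => by simp [h] at hn₁
  have ha0 : a ≠ 0 := fun h => hn₁0 (by rw [← hba, h, mul_zero])
  have hb0 : b ≠ 0 := fun h => hn₁0 (by rw [← hba, h]; simp)
  have haodd : Odd a := by
    refine Nat.odd_iff.mpr ?_
    by_contra h2
    have : 2 ∣ n₁ := hba ▸ Dvd.dvd.mul_left (Nat.dvd_of_mod_eq_zero (by omega)) _
    exact (Nat.not_even_iff_odd.mpr hn₁) (even_iff_two_dvd.mpr this)
  have hbn : b ≤ n := by
    rw [hnw, ← hba]
    calc b ≤ b ^ 2 := Nat.le_self_pow two_ne_zero b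
      _ ≤ b ^ 2 * a := Nat.le_mul_of_pos_right _ (Nat.pos_of_ne_zero ha0)
      _ ≤ 2 ^ w * (b ^ 2 * a) := Nat.le_mul_of_pos_left _ (by positivity)
  -- `D = sign D * 2^w * b^2 * a`
  have hDeq : D = D.sign * ((2 : ℤ) ^ w * (((b : ℤ) ^ 2) * (a : ℤ))) := by
    conv_lhs => rw [← Int.sign_mul_natAbs D]
    rw [← hn, hnw, ← hba]
    push_cast
    ring
  by_cases ha1 : a = 1
  · -- Case `|D| = 2^w b²`
    rcases Nat.even_or_odd w with hw | hw
    · -- `w` even: the sign must be negative; take `c ≡ 3 (mod 4)`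
      have hsign : D.sign = -1 := by
        rcases lt_or_gt_of_ne hD0 with h | h
        · exact Int.sign_eq_neg_one_of_neg h
        · exfalso
          apply hD
          obtain ⟨v, hv⟩ := hw
          refine ⟨(2 : ℤ) ^ v * b, ?_⟩
          rw [hDeq, Int.sign_eq_one_of_pos h, ha1, hv]
          push_cast
          ring
      obtain ⟨c, hcn, hc, hc3⟩ := Nat.forall_exists_prime_gt_and_modEq n (q := 4) (a := 3)
        (by norm_num) (by norm_num)
      have hc4 : c % 4 = 3 := hc3
      have hcodd : Odd c := Nat.odd_iff.mpr (by omega)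
      refine ⟨c, hc, hcodd, hcn, ?_⟩
      obtain ⟨v, hv⟩ := hw
      have hcb : ¬ c ∣ 2 ^ v * b := by
        intro h
        rcases (Nat.Prime.dvd_mul hc).mp h with h2 | h2
        · have := Nat.le_of_dvd two_pos (Nat.Prime.dvd_of_dvd_pow hc h2)
          omega
        · have := Nat.le_of_dvd (Nat.pos_of_ne_zero hb0) h2
          omega
      have hsq : (2 : ℤ) ^ w * (((b : ℤ) ^ 2) * ((1 : ℕ) : ℤ)) = (((2 ^ v * b : ℕ) : ℤ)) ^ 2 := by
        rw [hv]; push_cast; ring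
      rw [hDeq, hsign, ha1, hsq, jacobiSym.mul_left, jacobiSym.at_neg_one hcodd,
        ZMod.χ₄_nat_three_mod_four hc4, jacobiSym_sq_eq_one hc hcb]
      norm_num
    · -- `w` odd: take `c ≡ 5 (mod 8)`
      obtain ⟨c, hcn, hc, hc5⟩ := Nat.forall_exists_prime_gt_and_modEq n (q := 8) (a := 5)
        (by norm_num) (by norm_num)
      have hc8 : c % 8 = 5 := hc5
      have hcodd : Odd c := Nat.odd_iff.mpr (by omega)
      refine ⟨c, hc, hcodd, hcn, ?_⟩
      have hcb : ¬ c ∣ b := fun h2 => by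
        have := Nat.le_of_dvd (Nat.pos_of_ne_zero hb0) h2
        omega
      obtain ⟨h8, -⟩ := χ₈_χ₄_of_mod_eight_eq_five hc8
      rw [hDeq, ha1, Nat.cast_one, mul_one, jacobiSym.mul_left, jacobiSym.mul_left,
        jacobiSym_sign_eq_one hD0 (by omega), jacobiSym.pow_left, jacobiSym.at_two hcodd, h8,
        Odd.neg_one_pow hw, jacobiSym_sq_eq_one hc hcb]
      norm_num
  · -- Case `a ≠ 1`: an odd prime `p ∣ a` with `p ∤ a' = a/p`
    have hpprime : a.minFac.Prime := Nat.minFac_prime ha1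
    obtain ⟨a', ha'⟩ := (Nat.minFac_dvd a : a.minFac ∣ a)
    set p := a.minFac with hp
    have hpodd : Odd p := haodd.of_dvd_nat ⟨a', ha'⟩
    have hp2 : p ≠ 2 := fun h => by
      rw [h] at hpodd
      exact (Nat.not_even_iff_odd.mpr hpodd) even_two
    have ha'0 : a' ≠ 0 := fun h => ha0 (by rw [ha', h, mul_zero])
    have hpa' : ¬ p ∣ a' := by
      rintro ⟨e, he⟩
      have hsq : p * p ∣ a := ⟨e, by rw [ha', he]; ring⟩
      have := ha p hsq
      rw [Nat.isUnit_iff] at this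
      exact hpprime.one_lt.ne' this
    -- a non-residue `g` mod `p`
    haveI : Fact p.Prime := ⟨hpprime⟩
    obtain ⟨g, hg⟩ := FiniteField.exists_nonsquare (F := ZMod p)
      (by rw [ZMod.ringChar_zmod_n]; exact hp2)
    have hg0 : g ≠ 0 := fun h0 => hg (h0 ▸ IsSquare.zero)
    have hgval : ¬ p ∣ g.val := fun h => hg0 (by
      rw [← ZMod.natCast_zmod_val g]
      exact (ZMod.natCast_eq_zero_iff _ _).mpr h)
    -- CRT: `c₀ ≡ g (mod p)`, `c₀ ≡ 1 (mod 8 a')`, and Dirichlet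
    have hcop : Nat.Coprime p (8 * a') := by
      refine Nat.Coprime.mul_right ?_ ((Nat.Prime.coprime_iff_not_dvd hpprime).mpr hpa')
      rw [show (8 : ℕ) = 2 ^ 3 by norm_num]
      exact Nat.Coprime.pow_right 3 ((Nat.coprime_primes hpprime Nat.prime_two).mpr hp2)
    obtain ⟨c₀, hc₀p, hc₀a⟩ := Nat.chineseRemainder hcop g.val 1
    have hc₀cop : Nat.Coprime c₀ (p * (8 * a')) := by
      refine Nat.Coprime.mul_right ?_ ?_
      · rw [Nat.Coprime, hc₀p.gcd_eq]
        exact Nat.Coprime.symm ((Nat.Prime.coprime_iff_not_dvd hpprime).mpr hgval)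
      · rw [Nat.Coprime, hc₀a.gcd_eq, Nat.gcd_one_left]
    obtain ⟨c, hcn, hc, hcc₀⟩ := Nat.forall_exists_prime_gt_and_modEq n
      (mul_ne_zero hpprime.ne_zero (by omega : 8 * a' ≠ 0)) hc₀cop
    have hcp : c ≡ g.val [MOD p] := (hcc₀.of_mul_right (8 * a')).trans hc₀p
    have hca : c ≡ 1 [MOD 8 * a'] := (hcc₀.of_mul_left p).trans hc₀a
    have hc8 : c % 8 = 1 := hca.of_mul_right a'
    have hca' : c ≡ 1 [MOD a'] := hca.of_mul_left 8
    have hcodd : Odd c := Nat.odd_iff.mpr (by omega)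
    have hc4 : c % 4 = 1 := by omega
    refine ⟨c, hc, hcodd, hcn, ?_⟩
    have hcb : ¬ c ∣ b := fun h2 => by
      have := Nat.le_of_dvd (Nat.pos_of_ne_zero hb0) h2
      omega
    obtain ⟨h8, -⟩ := χ₈_χ₄_of_mod_eight_eq_one hc8
    -- `J(D|c) = J(sign|c) J(2|c)^w J(b²|c) J(a|c) = J(a|c)`
    rw [hDeq, jacobiSym.mul_left, jacobiSym.mul_left, jacobiSym.mul_left,
      jacobiSym_sign_eq_one hD0 hc4, jacobiSym.pow_left, jacobiSym.at_two hcodd, h8, one_pow,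
      jacobiSym_sq_eq_one hc hcb, one_mul, one_mul, one_mul]
    -- `J(a|c) = J(c|a) = J(c|p) J(c|a') = (-1)(1)`
    rw [jacobiSym.quadratic_reciprocity_one_mod_four' haodd hc4, ha']
    haveI : NeZero p := ⟨hpprime.ne_zero⟩
    haveI : NeZero a' := ⟨ha'0⟩
    rw [jacobiSym.mul_right]
    have h1 : jacobiSym (c : ℤ) p = -1 := by
      refine ZMod.nonsquare_iff_jacobiSym_eq_neg_one.mpr ?_
      have : ((c : ℤ) : ZMod p) = g := by
        rw [Int.cast_natCast, (ZMod.natCast_eq_natCast_iff _ _ _).mpr hcp, ZMod.natCast_zmod_val]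
      rw [this]
      exact hg
    have h2 : jacobiSym (c : ℤ) a' = 1 := by
      have hmod : (c : ℤ) % (a' : ℕ) = (1 : ℤ) % (a' : ℕ) := by
        have := congrArg (fun m : ℕ => (m : ℤ)) hca'
        push_cast at this
        exact this
      rw [jacobiSym.mod_left' hmod, jacobiSym.one_left]
    rw [h1, h2]
    norm_num


/-! ### Primes in prescribed classes -/

/-- `k` distinct primes `≡ 1 (mod 4)` above a bound (Dirichlet). [folklore] -/
theorem exists_injective_prime_mod_four_gt (k N : ℕ) :
    ∃ ℓ : Fin k → ℕ, Function.Injective ℓ ∧ ∀ i, (ℓ i).Prime ∧ ℓ i % 4 = 1 ∧ N < ℓ i := by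
  set S : Set ℕ := {p : ℕ | p.Prime ∧ p % 4 = 1 ∧ N < p} with hS
  have hSinf : S.Infinite := by
    refine Set.infinite_of_forall_exists_gt fun M => ?_
    obtain ⟨p, hMp, hp, hp4⟩ := Nat.forall_exists_prime_gt_and_modEq (max M N) (q := 4) (a := 1)
      (by norm_num) (by norm_num)
    exact ⟨p, ⟨hp, hp4, lt_of_le_of_lt (le_max_right _ _) hMp⟩, lt_of_le_of_lt (le_max_left _ _) hMp⟩
  let e : ℕ ↪ S := hSinf.natEmbedding
  exact ⟨fun i => (e i : ℕ), fun i j hij => Fin.val_injective (e.injective (Subtype.val_injective hij)),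
    fun i => (e i).2⟩

/-- **A prime in prescribed classes**: given distinct primes `ℓ_i` not dividing `A ≠ 0`,
residues `r_i` prime to `ℓ_i`, a residue `c₀` prime to `A` and a bound `N`, there is a prime
`m > N` with `m ≡ c₀ (mod A)` and `m ≡ r_i (mod ℓ_i)` for all `i` (Chinese remainder theorem
and Dirichlet's theorem on primes in arithmetic progressions). [folklore] -/
theorem exists_prime_gt_modEq_family {k : ℕ} (ℓ : Fin k → ℕ) (hℓ : ∀ i, (ℓ i).Prime)
    (hinj : Function.Injective ℓ) {A : ℕ} (hA : A ≠ 0) (hℓA : ∀ i, ¬ ℓ i ∣ A)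
    (r : Fin k → ℕ) (hr : ∀ i, Nat.Coprime (r i) (ℓ i)) (c₀ : ℕ) (hc₀ : Nat.Coprime c₀ A)
    (N : ℕ) : ∃ m : ℕ, N < m ∧ m.Prime ∧ m ≡ c₀ [MOD A] ∧ ∀ i, m ≡ r i [MOD ℓ i] := by
  -- moduli and residues indexed by `Option (Fin k)`
  let s : Option (Fin k) → ℕ := fun o => o.elim A ℓ
  let a : Option (Fin k) → ℕ := fun o => o.elim c₀ r
  have hs : ∀ o ∈ (Finset.univ : Finset (Option (Fin k))), s o ≠ 0 := by
    rintro (_ | i) -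
    · exact hA
    · exact (hℓ i).ne_zero
  have hpp : Set.Pairwise (↑(Finset.univ : Finset (Option (Fin k)))) (Function.onFun Nat.Coprime s) := by
    rintro (_ | i) - (_ | j) - hij
    · exact absurd rfl hij
    · exact Nat.Coprime.symm ((Nat.Prime.coprime_iff_not_dvd (hℓ j)).mpr (hℓA j))
    · exact (Nat.Prime.coprime_iff_not_dvd (hℓ i)).mpr (hℓA i)
    · exact (Nat.coprime_primes (hℓ i) (hℓ j)).mpr fun h => hij (congrArg some (hinj h))
  obtain ⟨R, hR⟩ := Nat.chineseRemainderOfFinset a s Finset.univ hs hpp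
  have hRcop : Nat.Coprime R (∏ o ∈ (Finset.univ : Finset (Option (Fin k))), s o) := by
    refine Nat.coprime_prod_right_iff.mpr fun o ho => ?_
    rw [Nat.Coprime, (hR o ho).gcd_eq]
    rcases o with _ | i
    · exact hc₀
    · exact hr i
  have hprod0 : (∏ o ∈ (Finset.univ : Finset (Option (Fin k))), s o) ≠ 0 :=
    Finset.prod_ne_zero_iff.mpr hs
  obtain ⟨m, hNm, hm, hmR⟩ := Nat.forall_exists_prime_gt_and_modEq N hprod0 hRcop
  refine ⟨m, hNm, hm, ?_, fun i => ?_⟩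
  · exact ((hmR.of_dvd (Finset.dvd_prod_of_mem s (Finset.mem_univ none))).trans
      (hR none (Finset.mem_univ _)) : _)
  · exact ((hmR.of_dvd (Finset.dvd_prod_of_mem s (Finset.mem_univ (some i)))).trans
      (hR (some i) (Finset.mem_univ _)) : _)

/-- The Legendre symbol of `m` at the odd prime `ℓ` only depends on `m mod ℓ`. [folklore] -/
theorem jacobiSym_eq_of_modEq {m r ℓ : ℕ} (h : m ≡ r [MOD ℓ]) :
    jacobiSym (m : ℤ) ℓ = jacobiSym (r : ℤ) ℓ := by
  apply jacobiSym.mod_left'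
  have := congrArg (fun n : ℕ => (n : ℤ)) h
  push_cast at this
  exact this

end QuadraticFieldAux

open QuadraticFieldAux in
/-- **Discharge of `Matsuno2009_sec6_exists_primes`** (Matsuno 2009, §6, p. 459: the primes
`ℓ_i, m_j` with (A1), (A4) and — in the corrected form — (A3) for the `m_j`, for every
quadratic field `K`): Dirichlet's theorem and the Chinese remainder theorem for the congruence
conditions, quadratic reciprocity for (A4), and the inertness of non-residue primes in a
quadratic field for (A3); see the module docstring for the route.
[cite: Matsuno2009, §6 (p. 459), conditions (A1), (A3), (A4) of §5 (p. 456)] -/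
theorem Matsuno2009_sec6_exists_primes_holds : Matsuno2009_sec6_exists_primes := by
  intro K _ _ _ hK k
  -- a degree-2 integer `x`, its discriminant `D`, and a prime `c₀` with `J(D|c₀) = -1`
  obtain ⟨x, hdeg⟩ := exists_natDegree_minpoly_eq_two (K := K) hK
  set D : ℤ := discrim (1 : ℤ) ((minpoly ℤ x).coeff 1) ((minpoly ℤ x).coeff 0) with hDdef
  have hDsq : ¬ IsSquare D := not_isSquare_disc hdeg
  have hD0 : D ≠ 0 := fun h => hDsq (by rw [h]; exact IsSquare.zero)
  obtain ⟨c₀, hc₀, hc₀odd, hc₀D, hJ₀⟩ := exists_prime_jacobiSym_eq_neg_one hD0 hDsq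
  set A : ℕ := 4 * D.natAbs with hAdef
  have hA0 : A ≠ 0 := by rw [hAdef]; exact mul_ne_zero (by norm_num) (Int.natAbs_ne_zero.mpr hD0)
  have hc₀A : Nat.Coprime c₀ A := by
    rw [hAdef, show (4 : ℕ) = 2 ^ 2 by norm_num]
    refine Nat.Coprime.mul_right (Nat.Coprime.pow_right 2 ?_) ?_
    · exact (Nat.coprime_primes hc₀ Nat.prime_two).mpr fun h => by
        rw [h] at hc₀odd; exact (Nat.not_even_iff_odd.mpr hc₀odd) even_two
    · exact (Nat.Prime.coprime_iff_not_dvd hc₀).mpr fun h =>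
        absurd (Nat.le_of_dvd (Int.natAbs_pos.mpr hD0) h) (not_le.mpr hc₀D)
  -- Step 1: the primes `ℓ_i ≡ 1 (mod 4)`, larger than `A`
  obtain ⟨ℓ, hℓinj, hℓ⟩ := exists_injective_prime_mod_four_gt k A
  have hℓp : ∀ i, (ℓ i).Prime := fun i => (hℓ i).1
  have hℓ4 : ∀ i, ℓ i % 4 = 1 := fun i => (hℓ i).2.1
  have hℓA : ∀ i, ¬ ℓ i ∣ A := fun i h =>
    absurd (Nat.le_of_dvd (Nat.pos_of_ne_zero hA0) h) (not_le.mpr (hℓ i).2.2)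
  have hℓ2 : ∀ i, ℓ i ≠ 2 := fun i h => by have := hℓ4 i; omega
  -- non-residues `g_i mod ℓ_i`
  have hg : ∀ i, ∃ g : ZMod (ℓ i), ¬ IsSquare g := fun i => by
    haveI : Fact (ℓ i).Prime := ⟨hℓp i⟩
    exact FiniteField.exists_nonsquare (F := ZMod (ℓ i)) (by rw [ZMod.ringChar_zmod_n]; exact hℓ2 i)
  choose g hg using hg
  have hg0 : ∀ i, g i ≠ 0 := fun i h0 => hg i (h0 ▸ IsSquare.zero)
  have hgval : ∀ i, ¬ ℓ i ∣ (g i).val := fun i h => hg0 i (by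
    haveI : NeZero (ℓ i) := ⟨(hℓp i).ne_zero⟩
    rw [← ZMod.natCast_zmod_val (g i)]
    exact (ZMod.natCast_eq_zero_iff _ _).mpr h)
  -- Step 2: the primes `m_j`
  let r : Fin k → Fin k → ℕ := fun j i => if i = j then (g i).val else 1
  have hr : ∀ j i, Nat.Coprime (r j i) (ℓ i) := by
    intro j i
    by_cases hij : i = j
    · simp only [r, if_pos hij]
      exact Nat.Coprime.symm ((Nat.Prime.coprime_iff_not_dvd (hℓp i)).mpr (hgval i))
    · simp only [r, if_neg hij]
      exact Nat.coprime_one_left _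
  have hm : ∀ j : Fin k, ∃ m : ℕ, (A + c₀ + ∑ i, ℓ i) < m ∧ m.Prime ∧ m ≡ c₀ [MOD A] ∧
      ∀ i, m ≡ r j i [MOD ℓ i] := fun j =>
    exists_prime_gt_modEq_family ℓ hℓp hℓinj hA0 hℓA (r j) (hr j) c₀ hc₀A _
  choose m hmN hmp hmc₀ hmr using hm
  -- properties of the `m_j`
  have hmodd : ∀ j, Odd (m j) := fun j => by
    have h2 : m j ≡ c₀ [MOD 2] := (hmc₀ j).of_dvd ⟨2 * D.natAbs, by rw [hAdef]; ring⟩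
    rw [Nat.odd_iff, h2]
    exact Nat.odd_iff.mp hc₀odd
  have hℓ_lt_m : ∀ i j, ℓ i < m j := fun i j =>
    lt_of_le_of_lt ((Finset.single_le_sum (fun i _ => Nat.zero_le (ℓ i)) (Finset.mem_univ i)).trans
      (Nat.le_add_left _ _)) (hmN j)
  have hJ : ∀ i j, jacobiSym (m j : ℤ) (ℓ i) = if i = j then -1 else 1 := by
    intro i j
    haveI : Fact (ℓ i).Prime := ⟨hℓp i⟩
    rw [jacobiSym_eq_of_modEq (hmr j i)]
    by_cases hij : i = j
    · simp only [r, if_pos hij]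
      refine ZMod.nonsquare_iff_jacobiSym_eq_neg_one.mpr ?_
      rw [Int.cast_natCast, ZMod.natCast_zmod_val]
      exact hg i
    · simp only [r, if_neg hij, Nat.cast_one, jacobiSym.one_left]
  have hminj : Function.Injective m := by
    intro j j' h
    by_contra hjj'
    have h1 := hJ j j
    have h2 := hJ j j'
    rw [if_pos rfl] at h1
    rw [if_neg hjj', ← h, h1] at h2
    norm_num at h2
  -- Step 3: the `m_j` are inert (`J(D | m_j) = J(D | c₀) = -1`)
  have hinert : ∀ j, (Ideal.span ({(m j : 𝓞 K)} : Set (𝓞 K))).IsPrime := by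
    intro j
    refine isPrime_span_of_not_isSquare hK hdeg (hmp j) (ZMod.nonsquare_of_jacobiSym_eq_neg_one ?_)
    rw [jacobiSym.mod_right D (hmodd j), ← hAdef, (hmc₀ j : m j % A = c₀ % A),
      hAdef, ← jacobiSym.mod_right D hc₀odd]
    exact hJ₀
  exact ⟨ℓ, m, hℓp, hmp, hℓ4, hmodd, hℓinj, hminj, fun i j => (hℓ_lt_m i j).ne, hinert, hJ⟩

end Literature.NumberTheory.EllipticCurves

end
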